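import Literature.AnabelianGeometry.SemiGraphs.TemperedSpecialFibreTowerAugOpenProofs
import Literature.AnabelianGeometry.SemiGraphs.TemperedQuotientByClosedNormal
import Literature.AnabelianGeometry.SemiGraphs.TemperedSpecialFibreGraphEquivalence
import Literature.AnabelianGeometry.SemiGraphs.CharacteristicOpenCore
import HarnessLib

/-!
# [SemiAnbd] Example 3.10 — END-KNIT of the printed content at a certified datum, and the
# CANONICAL choice of "an exhaustive sequence of open characteristic subgroups of finite index"

Mochizuki, *Semi-graphs of anabelioids*, Publ. RIMS **42** (2006), Example 3.10, kurims manuscript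
pp. 43–45 (PRIMS pp. 268–270) [cite: MochizukiSemiAnbd2006, Ex 3.10 pp.43-45].

PROOF-ONLY file (cell abc-iut, DAG node `SemiAnbd:Ex3.10`, CONE-BOARD class CLAIM-NOW/verify, seat
abc-iut-w4-d096 gen 9; no `def`, no `instance`, no new named fact).  The node's statement file
`TemperedCurves.lean` (p405241, DEFS-FROZEN) types the OBJECTS of Example 3.10 as the interface
`TemperedArithmeticGroup K`; the sub-DAG files type and prove the ARGUMENT.  This file assembles, BY
NAME, the kernel closers of every printed clause of Example 3.10 into ONE theorem at a datum `D`
carrying certified special-fibre data `S` under an origin `Ω` — conditional on exactly the ONE named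
ORIGIN input `Ex310TowerStatement Ω` (FACT-policy: André's `π₁^temp`, the stable model and Example 2.10
are not constructed in the tree; nothing is asserted for any `Ω`):

* `example_3_10_of_ex310TowerStatement` — for `K` any field with `G_K` slim, and print's "Now suppose
  that we are given an exhaustive sequence of open characteristic [hence normal] subgroups of finite
  index `… ⊆ N_i ⊆ … ⊆ Δ`" (p. 44 l. 14–17) as displayed binders:
  (C1)(C2) p. 43 l. 35 – p. 44 l. 1 "`π₁^temp(X^log_K)` is a tempered topological group and fits into a
  natural exact sequence `1 → Δ → Π → G_K → 1` … `Δ` is also tempered, so we obtain temperoids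
  `B^temp(Π)`; `B^temp(Δ)`" — `isTempered`/`isTempered_ker` (interface fields),
  `isTemperoid_bTemp_pi/_delta`, `isHomeomorph_quotientDeltaEquiv` (the sequence is one of
  TOPOLOGICAL groups; abc-iut-w6-d068, p432620);
  (C4) p. 44 l. 9–13 "a natural equivalence `B^temp(𝒢) ⥲ B^temp(𝒢^c)` and a natural full embedding
  `B^temp(𝒢) ↪ B^temp(Δ)`" — `SpecialFibreData.nonempty_btempCat_equivalence_graphOf` (p437308),
  `SpecialFibreData.fullEmbedding_full/_faithful` (p432620);
  (C5)–(C8) p. 44 l. 14 – p. 45 l. 21 the special-fibre tower with the GIVEN levels `N_i` EXISTS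
  (`Ex310TowerStatement`, the origin input), lies over `S` ("`… ↠ π₁^temp(𝒢)`"), and every
  "`Δ[i] := π₁^temp(𝒢_i) ⋊^out Δ_i`" is tempered (`SpecialFibreTower.isTempered_level`, p433755) and
  temp-slim (`SpecialFibreTower.isSlimGroup_level`, abc-iut-w5-d122);
  (C9) p. 45 l. 22–23 "both `Δ` and `Π` are temp-slim" —
  `isSlimGroup_of_ex310TowerStatement_of_slim_galois` (p416868; the `AugIsOpenMap` binder of the
  sub-DAG file is the THEOREM `augIsOpenMap_holds`, F-1696);
* `example_3_10_of_ex310TowerStatement_padic` — the printed setting "`K` a finite extension of `ℚ_p`"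
  (p. 43 l. 22–23): `G_K` slim is the tree THEOREM `galoisMLF_slim_holds` ([AbsAnab] Thm. 1.1.1 (ii),
  F-0027), so NO binder remains beyond the origin input and the given sequence `N_i`;
* NEW (binder reduction): the sequence `N_i` need not be GIVEN — the CHARACTERISTIC OPEN CORES
  `charOpenCore Δ i := ⋂ {U ≤ Δ open, [Δ : U] ≤ i}` (`CharacteristicOpenCore.lean`, abc-iut-w4-d053;
  Dixon–du Sautoy–Mann–Segal Prop. 1.6) are a canonical such sequence as soon as (FIN) `Δ` has only
  finitely many open subgroups of each bounded index (e.g. `Δ` topologically finitely generated) and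
  (RF) the open finite-index subgroups of `Δ` separate points — `charOpenCore_charLevels`; hence
  `exists_specialFibreTower_charOpenCore_of_ex310TowerStatement`,
  `isSlimGroup_of_ex310TowerStatement_of_finite_openSubgroups` (+ `_of_tfg`, `_padic`) and the
  END-KNIT in canonical form `example_3_10_of_ex310TowerStatement_charOpenCore`.

Honest limits: PROVED modulo the displayed origin binder `(h : Ex310TowerStatement Ω)` (its
satisfiability at a non-empty certificate is the tree theorem `Ex310TowerStatement.exists_nonvacuous`,
p441073; towers with GENUINE fibres over `π₁^temp(𝒢)` exist by `SpecialFibreTower.nonempty_temperedPi`,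
p444149); the semi-graph-level generalized morphisms `𝒢_i → 𝒢_j` (Def. 2.11, p. 44 l. 29–47) enter
only through their printed effect on tempered groups (`admKer_antitone`, `LiesOver`), as in the
sub-DAG file.  Refereed 2006 material; nothing here bears on [IUTchIII] Cor. 3.12 or takes a side on
any disputed claim; typed ≠ proved for the origin statement itself.
-/

noncomputable section

namespace Literature.AnabelianGeometry.SemiGraphs

open CategoryTheory Topology ProfiniteSemiGraph
open Literature.AlgebraicGeometry.Frobenioids (IsSlimGroup)
open Literature.AnabelianGeometry.AbsoluteAnabelian (galoisMLF_slim_holds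
  IsTopologicallyFinitelyGenerated)

universe u

/-! ### The canonical exhaustive sequence of open characteristic subgroups of finite index -/

section CanonicalLevels

variable {Δ : Type u} [Group Δ] [TopologicalSpace Δ]

/-- (RF) ⇒ exhaustiveness: if the open subgroups of finite index of `Δ` separate points, the
characteristic open cores `⋂_i charOpenCore Δ i` meet in `{1}` (each core lies below every open subgroup
of index at most its level). [cite: DixonEtAl1999, Prop 1.6] -/
theorem charOpenCore_exhaustive_of_separating
    (hrf : ∀ g : Δ, g ≠ 1 → ∃ U : Subgroup Δ, IsOpen (U : Set Δ) ∧ U.FiniteIndex ∧ g ∉ U)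
    (g : Δ) (hg : ∀ i, g ∈ charOpenCore Δ i) : g = 1 := by
  by_contra hne
  obtain ⟨U, hUo, hUf, hgU⟩ := hrf g hne
  haveI := hUf
  exact hgU (charOpenCore_le_of_finiteIndex U hUo (hg U.index))

/-- **The characteristic open cores are "an exhaustive sequence of open characteristic [hence normal]
subgroups of finite index `… ⊆ N_i ⊆ … ⊆ Δ`"** ([SemiAnbd] Ex. 3.10 p. 44 l. 14–17) — in exactly the
six-clause form the Example-3.10 statements bind — for every topological group `Δ` with (FIN) finitely
many open subgroups of each bounded index and (RF) open finite-index subgroups separating points.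
[cite: MochizukiSemiAnbd2006, Ex 3.10 p.44] -/
theorem charOpenCore_charLevels [IsTopologicalGroup Δ]
    (hfin : ∀ d, (openSubgroupsIndexLE Δ d).Finite)
    (hrf : ∀ g : Δ, g ≠ 1 → ∃ U : Subgroup Δ, IsOpen (U : Set Δ) ∧ U.FiniteIndex ∧ g ∉ U) :
    Antitone (charOpenCore Δ) ∧ (∀ i, IsOpen (charOpenCore Δ i : Set Δ)) ∧
      (∀ (i) (φ : Δ ≃ₜ* Δ), (charOpenCore Δ i).map φ.toMulEquiv.toMonoidHom = charOpenCore Δ i) ∧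
      (∀ i, (charOpenCore Δ i).Normal) ∧ (∀ i, (charOpenCore Δ i).FiniteIndex) ∧
      (∀ g : Δ, (∀ i, g ∈ charOpenCore Δ i) → g = 1) :=
  ⟨fun _ _ h => charOpenCore_anti h, fun i => isOpen_charOpenCore (hfin i),
    fun _ φ => map_charOpenCore_eq φ.toMulEquiv φ.continuous φ.symm.continuous,
    fun i => charOpenCore_normal i,
    fun i => Subgroup.finiteIndex_iff.mpr (charOpenCore_index_ne_zero (hfin i)),
    charOpenCore_exhaustive_of_separating hrf⟩

/-- (FIN) holds in every topologically finitely generated topological group ([AbsTopI] §0;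
`openSubgroupsIndexLE_finite_of_isTopologicallyFinitelyGenerated`), so there the characteristic open
cores are such a sequence as soon as (RF) holds. [cite: MochizukiSemiAnbd2006, Ex 3.10 p.44] -/
theorem charOpenCore_charLevels_of_tfg [IsTopologicalGroup Δ] (htfg : IsTopologicallyFinitelyGenerated Δ)
    (hrf : ∀ g : Δ, g ≠ 1 → ∃ U : Subgroup Δ, IsOpen (U : Set Δ) ∧ U.FiniteIndex ∧ g ∉ U) :
    Antitone (charOpenCore Δ) ∧ (∀ i, IsOpen (charOpenCore Δ i : Set Δ)) ∧
      (∀ (i) (φ : Δ ≃ₜ* Δ), (charOpenCore Δ i).map φ.toMulEquiv.toMonoidHom = charOpenCore Δ i) ∧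
      (∀ i, (charOpenCore Δ i).Normal) ∧ (∀ i, (charOpenCore Δ i).FiniteIndex) ∧
      (∀ g : Δ, (∀ i, g ∈ charOpenCore Δ i) → g = 1) :=
  charOpenCore_charLevels (openSubgroupsIndexLE_finite_of_isTopologicallyFinitelyGenerated htfg) hrf

end CanonicalLevels

/-! ### Example 3.10 from the origin statement with the CANONICAL levels -/

section Canonical

variable {K : Type u} [Field K]

/-- **The special-fibre tower of Example 3.10 over the characteristic open cores of `Δ`**: under the
origin statement `Ex310TowerStatement Ω`, at every certified datum whose `Δ` satisfies (FIN) and (RF)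
the tower with levels `N_i := charOpenCore Δ i` EXISTS and lies over the certified special-fibre data
("`… ↠ Δ[j] ↠ … ↠ π₁^temp(𝒢)`", p. 45 l. 1–4) — print's "Now suppose that we are given an exhaustive
sequence …" (p. 44 l. 14) discharged by the canonical choice. [cite: MochizukiSemiAnbd2006, Ex 3.10 p.44] -/
theorem exists_specialFibreTower_charOpenCore_of_ex310TowerStatement {Ω : SpecialFibreOrigin K}
    (h : Ex310TowerStatement Ω) {D : TemperedArithmeticGroup K} {S : SpecialFibreData D}
    (hS : Ω.IsSpecialFibreOf D S) (hfin : ∀ d, (openSubgroupsIndexLE D.delta d).Finite)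
    (hrf : ∀ g : D.delta, g ≠ 1 →
      ∃ U : Subgroup D.delta, IsOpen (U : Set D.delta) ∧ U.FiniteIndex ∧ g ∉ U) :
    ∃ T : SpecialFibreTower D.delta, T.N = charOpenCore D.delta ∧ T.LiesOver S := by
  obtain ⟨hanti, hopen, hchar, hnormal, hfi, hexh⟩ := charOpenCore_charLevels hfin hrf
  exact h D S hS _ hanti hopen hchar hnormal hfi hexh

/-- **"both `Δ` and `Π` are temp-slim"** (p. 45 l. 22–23) from the origin statement, the slimness of
`G_K`, and ONLY the two structural properties (FIN), (RF) of `Δ` — no sequence `N_i` is a binder.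
[cite: MochizukiSemiAnbd2006, Ex 3.10 p.45] -/
theorem isSlimGroup_of_ex310TowerStatement_of_finite_openSubgroups {Ω : SpecialFibreOrigin K}
    (h : Ex310TowerStatement Ω) {D : TemperedArithmeticGroup K} {S : SpecialFibreData D}
    (hS : Ω.IsSpecialFibreOf D S) (hfin : ∀ d, (openSubgroupsIndexLE D.delta d).Finite)
    (hrf : ∀ g : D.delta, g ≠ 1 →
      ∃ U : Subgroup D.delta, IsOpen (U : Set D.delta) ∧ U.FiniteIndex ∧ g ∉ U)
    (hG : IsSlimGroup (Field.absoluteGaloisGroup K)) : IsSlimGroup D.delta ∧ IsSlimGroup D.Pi := by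
  obtain ⟨hanti, hopen, hchar, hnormal, hfi, hexh⟩ := charOpenCore_charLevels hfin hrf
  exact isSlimGroup_of_ex310TowerStatement_of_slim_galois h hS _ hanti hopen hchar hnormal hfi hexh hG

/-- The same with (FIN) supplied by topological finite generation of `Δ`.
[cite: MochizukiSemiAnbd2006, Ex 3.10 p.45] -/
theorem isSlimGroup_of_ex310TowerStatement_of_tfg {Ω : SpecialFibreOrigin K}
    (h : Ex310TowerStatement Ω) {D : TemperedArithmeticGroup K} {S : SpecialFibreData D}
    (hS : Ω.IsSpecialFibreOf D S) (htfg : IsTopologicallyFinitelyGenerated D.delta)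
    (hrf : ∀ g : D.delta, g ≠ 1 →
      ∃ U : Subgroup D.delta, IsOpen (U : Set D.delta) ∧ U.FiniteIndex ∧ g ∉ U)
    (hG : IsSlimGroup (Field.absoluteGaloisGroup K)) : IsSlimGroup D.delta ∧ IsSlimGroup D.Pi :=
  isSlimGroup_of_ex310TowerStatement_of_finite_openSubgroups h hS
    (openSubgroupsIndexLE_finite_of_isTopologicallyFinitelyGenerated htfg) hrf hG

/-- **The printed setting, "`K` a finite extension of `ℚ_p`"** (p. 43 l. 22–23): `Δ` and `Π` are
temp-slim from the origin statement and (FIN), (RF) ALONE — `G_K` slim is the tree theorem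
`galoisMLF_slim_holds` ([AbsAnab] Thm. 1.1.1 (ii)). [cite: MochizukiSemiAnbd2006, Ex 3.10 p.45] -/
theorem isSlimGroup_of_ex310TowerStatement_of_finite_openSubgroups_padic {p : ℕ} [Fact p.Prime]
    {K : Type} [Field K] [Algebra ℚ_[p] K] [FiniteDimensional ℚ_[p] K] {Ω : SpecialFibreOrigin K}
    (h : Ex310TowerStatement Ω) {D : TemperedArithmeticGroup K} {S : SpecialFibreData D}
    (hS : Ω.IsSpecialFibreOf D S) (hfin : ∀ d, (openSubgroupsIndexLE D.delta d).Finite)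
    (hrf : ∀ g : D.delta, g ≠ 1 →
      ∃ U : Subgroup D.delta, IsOpen (U : Set D.delta) ∧ U.FiniteIndex ∧ g ∉ U) :
    IsSlimGroup D.delta ∧ IsSlimGroup D.Pi :=
  isSlimGroup_of_ex310TowerStatement_of_finite_openSubgroups h hS hfin hrf (galoisMLF_slim_holds p K)

end Canonical

/-! ### END-KNIT: the printed content of Example 3.10 at a certified datum -/

section EndKnit

variable {K : Type u} [Field K]

/-- **[SemiAnbd] Example 3.10, END-KNIT** (kurims pp. 43–45): at a datum `D` carrying special-fibre
data `S` certified by an origin `Ω` satisfying the origin statement `Ex310TowerStatement Ω`, over a field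
`K` with slim `G_K`, and for a GIVEN "exhaustive sequence of open characteristic [hence normal] subgroups
of finite index `… ⊆ N_i ⊆ … ⊆ Δ`" (p. 44 l. 14–17):
(C1)(C2) `Π` and `Δ` are tempered, `B^temp(Π)` and `B^temp(Δ)` are temperoids, and
`1 → Δ → Π → G_K → 1` is exact as a sequence of TOPOLOGICAL groups (`Π/Δ ≃ G_K` a homeomorphism);
(C4) "a natural equivalence `B^temp(𝒢) ⥲ B^temp(𝒢^c)` and a natural full embedding
`B^temp(𝒢) ↪ B^temp(Δ)`"; (C5)–(C8) the special-fibre tower with levels `N_i` exists, lies over `S`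
("`… ↠ π₁^temp(𝒢)`"), and "each `Δ[i]`" is tempered and temp-slim; (C9) "both `Δ` and `Π` are
temp-slim".  Every conjunct is a tree theorem consumed BY NAME (module docstring); the ONLY
hypothesis beyond the printed data is the origin statement. [cite: MochizukiSemiAnbd2006, Ex 3.10 pp.43-45] -/
theorem example_3_10_of_ex310TowerStatement {Ω : SpecialFibreOrigin K} (h : Ex310TowerStatement Ω)
    {D : TemperedArithmeticGroup K} {S : SpecialFibreData D} (hS : Ω.IsSpecialFibreOf D S)
    (N : ℕ → Subgroup D.delta) (hanti : Antitone N) (hopen : ∀ i, IsOpen (N i : Set D.delta))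
    (hchar : ∀ (i) (φ : D.delta ≃ₜ* D.delta), (N i).map φ.toMulEquiv.toMonoidHom = N i)
    (hnormal : ∀ i, (N i).Normal) (hfi : ∀ i, (N i).FiniteIndex)
    (hexh : ∀ g, (∀ i, g ∈ N i) → g = 1) (hG : IsSlimGroup (Field.absoluteGaloisGroup K)) :
    (IsTempered D.Pi ∧ IsTempered D.delta ∧ IsTemperoid.{u, u, u + 1} (BTemp D.Pi) ∧
        IsTemperoid.{u, u, u + 1} (BTemp D.delta) ∧ IsHomeomorph D.quotientDeltaEquiv) ∧
      (Nonempty (BTempCat S.Gc ≌ BTempCat (S.Gc.restrict S.Gc.graph.maximalSubgraph)) ∧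
        (S.chart.equiv.functor ⋙ BTemp.res S.admissible).Full ∧
        (S.chart.equiv.functor ⋙ BTemp.res S.admissible).Faithful) ∧
      (∃ T : SpecialFibreTower D.delta, T.N = N ∧ T.LiesOver S ∧
        ∀ i, haveI := T.admKer_normal i; IsTempered (T.Level i) ∧ IsSlimGroup (T.Level i)) ∧
      (IsSlimGroup D.delta ∧ IsSlimGroup D.Pi) := by
  refine ⟨⟨D.isTempered, D.isTempered_ker, D.isTemperoid_bTemp_pi, D.isTemperoid_bTemp_delta,
      D.isHomeomorph_quotientDeltaEquiv⟩,
    ⟨S.nonempty_btempCat_equivalence_graphOf, S.fullEmbedding_full, S.fullEmbedding_faithful⟩, ?_,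
    isSlimGroup_of_ex310TowerStatement_of_slim_galois h hS N hanti hopen hchar hnormal hfi hexh hG⟩
  obtain ⟨T, hTN, hover⟩ := h D S hS N hanti hopen hchar hnormal hfi hexh
  exact ⟨T, hTN, hover, fun i => by
    haveI := T.admKer_normal i
    exact T.isTempered_and_isSlimGroup_level i⟩

/-- **END-KNIT, canonical form**: the same with print's "given an exhaustive sequence …" replaced by the
two structural properties (FIN), (RF) of `Δ` and the levels `N_i := charOpenCore Δ i`.
[cite: MochizukiSemiAnbd2006, Ex 3.10 pp.43-45] -/
theorem example_3_10_of_ex310TowerStatement_charOpenCore {Ω : SpecialFibreOrigin K}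
    (h : Ex310TowerStatement Ω) {D : TemperedArithmeticGroup K} {S : SpecialFibreData D}
    (hS : Ω.IsSpecialFibreOf D S) (hfin : ∀ d, (openSubgroupsIndexLE D.delta d).Finite)
    (hrf : ∀ g : D.delta, g ≠ 1 →
      ∃ U : Subgroup D.delta, IsOpen (U : Set D.delta) ∧ U.FiniteIndex ∧ g ∉ U)
    (hG : IsSlimGroup (Field.absoluteGaloisGroup K)) :
    (IsTempered D.Pi ∧ IsTempered D.delta ∧ IsTemperoid.{u, u, u + 1} (BTemp D.Pi) ∧
        IsTemperoid.{u, u, u + 1} (BTemp D.delta) ∧ IsHomeomorph D.quotientDeltaEquiv) ∧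
      (Nonempty (BTempCat S.Gc ≌ BTempCat (S.Gc.restrict S.Gc.graph.maximalSubgraph)) ∧
        (S.chart.equiv.functor ⋙ BTemp.res S.admissible).Full ∧
        (S.chart.equiv.functor ⋙ BTemp.res S.admissible).Faithful) ∧
      (∃ T : SpecialFibreTower D.delta, T.N = charOpenCore D.delta ∧ T.LiesOver S ∧
        ∀ i, haveI := T.admKer_normal i; IsTempered (T.Level i) ∧ IsSlimGroup (T.Level i)) ∧
      (IsSlimGroup D.delta ∧ IsSlimGroup D.Pi) := by
  obtain ⟨hanti, hopen, hchar, hnormal, hfi, hexh⟩ := charOpenCore_charLevels hfin hrf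
  exact example_3_10_of_ex310TowerStatement h hS _ hanti hopen hchar hnormal hfi hexh hG

/-- **END-KNIT in the printed setting "`K` a finite extension of `ℚ_p`"** (p. 43 l. 22–23): as
`example_3_10_of_ex310TowerStatement`, with `G_K` slim supplied by the tree theorem
`galoisMLF_slim_holds` ([AbsAnab] Thm. 1.1.1 (ii)) — NO binder beyond the origin statement and the
given sequence `N_i`. [cite: MochizukiSemiAnbd2006, Ex 3.10 pp.43-45] -/
theorem example_3_10_of_ex310TowerStatement_padic {p : ℕ} [Fact p.Prime] {K : Type} [Field K]
    [Algebra ℚ_[p] K] [FiniteDimensional ℚ_[p] K] {Ω : SpecialFibreOrigin K}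
    (h : Ex310TowerStatement Ω) {D : TemperedArithmeticGroup K} {S : SpecialFibreData D}
    (hS : Ω.IsSpecialFibreOf D S) (N : ℕ → Subgroup D.delta) (hanti : Antitone N)
    (hopen : ∀ i, IsOpen (N i : Set D.delta))
    (hchar : ∀ (i) (φ : D.delta ≃ₜ* D.delta), (N i).map φ.toMulEquiv.toMonoidHom = N i)
    (hnormal : ∀ i, (N i).Normal) (hfi : ∀ i, (N i).FiniteIndex)
    (hexh : ∀ g, (∀ i, g ∈ N i) → g = 1) :
    (IsTempered D.Pi ∧ IsTempered D.delta ∧ IsTemperoid.{0, 0, 1} (BTemp D.Pi) ∧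
        IsTemperoid.{0, 0, 1} (BTemp D.delta) ∧ IsHomeomorph D.quotientDeltaEquiv) ∧
      (Nonempty (BTempCat S.Gc ≌ BTempCat (S.Gc.restrict S.Gc.graph.maximalSubgraph)) ∧
        (S.chart.equiv.functor ⋙ BTemp.res S.admissible).Full ∧
        (S.chart.equiv.functor ⋙ BTemp.res S.admissible).Faithful) ∧
      (∃ T : SpecialFibreTower D.delta, T.N = N ∧ T.LiesOver S ∧
        ∀ i, haveI := T.admKer_normal i; IsTempered (T.Level i) ∧ IsSlimGroup (T.Level i)) ∧
      (IsSlimGroup D.delta ∧ IsSlimGroup D.Pi) :=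
  example_3_10_of_ex310TowerStatement h hS N hanti hopen hchar hnormal hfi hexh (galoisMLF_slim_holds p K)

/-- **END-KNIT, printed setting, canonical levels**: `K/ℚ_p` finite, (FIN) + (RF) for `Δ`; conditional
on the origin statement ONLY. [cite: MochizukiSemiAnbd2006, Ex 3.10 pp.43-45] -/
theorem example_3_10_of_ex310TowerStatement_charOpenCore_padic {p : ℕ} [Fact p.Prime] {K : Type}
    [Field K] [Algebra ℚ_[p] K] [FiniteDimensional ℚ_[p] K] {Ω : SpecialFibreOrigin K}
    (h : Ex310TowerStatement Ω) {D : TemperedArithmeticGroup K} {S : SpecialFibreData D}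
    (hS : Ω.IsSpecialFibreOf D S) (hfin : ∀ d, (openSubgroupsIndexLE D.delta d).Finite)
    (hrf : ∀ g : D.delta, g ≠ 1 →
      ∃ U : Subgroup D.delta, IsOpen (U : Set D.delta) ∧ U.FiniteIndex ∧ g ∉ U) :
    (IsTempered D.Pi ∧ IsTempered D.delta ∧ IsTemperoid.{0, 0, 1} (BTemp D.Pi) ∧
        IsTemperoid.{0, 0, 1} (BTemp D.delta) ∧ IsHomeomorph D.quotientDeltaEquiv) ∧
      (Nonempty (BTempCat S.Gc ≌ BTempCat (S.Gc.restrict S.Gc.graph.maximalSubgraph)) ∧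
        (S.chart.equiv.functor ⋙ BTemp.res S.admissible).Full ∧
        (S.chart.equiv.functor ⋙ BTemp.res S.admissible).Faithful) ∧
      (∃ T : SpecialFibreTower D.delta, T.N = charOpenCore D.delta ∧ T.LiesOver S ∧
        ∀ i, haveI := T.admKer_normal i; IsTempered (T.Level i) ∧ IsSlimGroup (T.Level i)) ∧
      (IsSlimGroup D.delta ∧ IsSlimGroup D.Pi) :=
  example_3_10_of_ex310TowerStatement_charOpenCore h hS hfin hrf (galoisMLF_slim_holds p K)

end EndKnit

end Literature.AnabelianGeometry.SemiGraphs

end
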